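import Summits.Ventures.QEC.Thresholds.ToricCodeXSectorThresholds
import Summits.Ventures.QEC.Thresholds.DepolarizingThresholdConverses
import Literature.InformationTheory.QuantumCodes.ToricCodeLatticeConverses
import HarnessLib

/-!
# The lattice toric code, census sector families: `p_c^X ≤ 1/4`, `p_c^Z ≤ 1/4` (every decoder family),
# `.0322 < p_c^X ≤ 1/4`, `.0483 < p_c^{depol} ≤ 3/8`

Venture QEC, `Summits/Ventures/QEC/Thresholds/` (LADDER-QEC rung Q5; qec-lit-2 gen 4). HONEST FRAMING. Completes
`ToricCodeLatticeThresholdConverses.lean` for the census-form families of the LATTICE toric code used by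
`ToricCodeXSectorThresholds.lean` / `ToricCodeDepolarizingKernel*.lean`:
`zFailureFamily (fun L => toricCode (L+1)) D` (`= toricFailureFamily D`, definitional), `xFailureFamily (fun L =>
toricCode (L+1)) DX` (`= toricFailureFamily (dualDecoder ∘ DX)`, `xFailureFamily_toricCode` — the tree's lattice duality
for decoders) and `depolarizingFailureFamily (fun L => toricCode (L+1)) DX DZ`:

* `toric_z_capacity_threshold_le_quarter'`, `toric_x_capacity_threshold_le_quarter`: `p₀ ≤ 1/4` for EVERY decoder
  family of either sector (ceiling of `ToricCodeLatticeConverses.lean`, transported to the `X`-sector by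
  `xFailureFamily_toricCode`);
* `toric_x_capacity_accuracyThreshold_mem`: **`.0322 < p_c^X ≤ 1/4`** (floor: Fisher–Sykes walk count, minimum-weight
  decoders of the plaquette syndrome);
* `toric_depolarizing_threshold_le_three_eighths`, `toric_depolarizing_accuracyThreshold_mem`: **`.0483 < p_c^{depol}
  ≤ 3/8`** under sector-wise decoding (floor: minimum-weight; ceiling: every pair of decoder families; printed optimum
  `≈ .189`, MWPM `≈ .155` — VALIDATED column).

Kernel axioms only; no named fact; no `native_decide`; no new definition.

## References

* [DennisEtAl2002] E. Dennis, A. Kitaev, A. Landahl, J. Preskill, J. Math. Phys. 43 (2002) 4452, §3.1, §4.1, §4.6, §5.3.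
* [RichardsonUrbanke2008] T. Richardson, R. Urbanke, *Modern Coding Theory*, Lemma 4.78 (Erasure Decomposition).
-/

noncomputable section

namespace Summit.Ventures.QEC.Thresholds

open Filter Topology
open Literature.InformationTheory.QuantumCodes
open Literature.InformationTheory.QuantumCodes.ToricCode

open Classical in
/-- **`Z`-sector, census form: `p₀ ≤ 1/4` for EVERY decoder family** of `zFailureFamily (toricCode ·) D`.
[cite: DennisEtAl2002, §4.6 (p_c); RichardsonUrbanke2008, Lemma 4.78] -/
theorem toric_z_capacity_threshold_le_quarter' (D : (L : ℕ) → ZDecoder (L + 1)) {a : ℝ}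
    (ha : IsThresholdLowerBound (zFailureFamily (fun L => toricCode (L + 1)) D) a) : a ≤ 1 / 4 := by
  rw [zFailureFamily_toricCode] at ha
  exact ToricCode.capacity_threshold_le_quarter D ha

open Classical in
/-- **`X`-sector: `p₀ ≤ 1/4` for EVERY decoder family** of the plaquette syndrome (bit flips on the lattice toric
code) — the `X`-sector family is the `Z`-sector family of the dual decoders. [cite: DennisEtAl2002, §3.1 and §4.1 (X errors on the dual lattice); RichardsonUrbanke2008, Lemma 4.78] -/
theorem toric_x_capacity_threshold_le_quarter (DX : (L : ℕ) → Decoder (Syndrome (L + 1)) (Chain (L + 1))) {a : ℝ}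
    (ha : IsThresholdLowerBound (xFailureFamily (fun L => toricCode (L + 1)) DX) a) : a ≤ 1 / 4 := by
  rw [xFailureFamily_toricCode] at ha
  exact ToricCode.capacity_threshold_le_quarter _ ha

open Classical in
/-- Accuracy-threshold form, `X`-sector, every decoder family: `p_c^X ≤ 1/4`. [cite: DennisEtAl2002, §4.6 (p_c)] -/
theorem toric_x_capacity_accuracyThreshold_le_quarter (DX : (L : ℕ) → Decoder (Syndrome (L + 1)) (Chain (L + 1))) :
    accuracyThreshold (xFailureFamily (fun L => toricCode (L + 1)) DX) ≤ 1 / 4 :=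
  toric_x_capacity_threshold_le_quarter DX (isThresholdLowerBound_accuracyThreshold _)

open Classical in
/-- **`.0322 < p_c^X ≤ 1/4` for bit flips on the toric code** — certified two-sided interval (floor: Fisher–Sykes walk
count, every minimum-weight decoder family of the plaquette syndrome; ceiling: every decoder family).
[cite: DennisEtAl2002, §5.3 eq. (p_c_2d) and §4.6; RichardsonUrbanke2008, Lemma 4.78] -/
theorem toric_x_capacity_accuracyThreshold_mem (DX : (L : ℕ) → Decoder (Syndrome (L + 1)) (Chain (L + 1)))
    (hDX : ∀ L, (DX L).IsMinWeight (toricCode (L + 1)).xSyndrome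
      ((toricCode (L + 1)).kerZ : Set (Chain (L + 1))) hammingNorm) :
    (0.0322 : ℝ) < accuracyThreshold (xFailureFamily (fun L => toricCode (L + 1)) DX) ∧
      accuracyThreshold (xFailureFamily (fun L => toricCode (L + 1)) DX) ≤ 1 / 4 :=
  ⟨toric_x_accuracyThreshold_gt_0322 DX hDX, toric_x_capacity_accuracyThreshold_le_quarter DX⟩

/-- **Depolarizing noise, sector-wise decoding of the lattice toric code: `p₀^{depol} ≤ 3/8`** for EVERY pair of
decoder families. [cite: DennisEtAl2002, §4.1 (depolarizing channel) and §4.6; RichardsonUrbanke2008, Lemma 4.78] -/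
theorem toric_depolarizing_threshold_le_three_eighths
    (DX : (L : ℕ) → Decoder (Syndrome (L + 1)) (Chain (L + 1))) (DZ : (L : ℕ) → ZDecoder (L + 1)) {a : ℝ}
    (ha : IsThresholdLowerBound (depolarizingFailureFamily (fun L => toricCode (L + 1)) DX DZ) a) : a ≤ 3 / 8 :=
  depolarizingThreshold_le_three_eighths (fun L => toricCode (L + 1)) (fun _ => toricCode_k_pos) DX DZ ha

/-- **`.0483 < p_c^{depol} ≤ 3/8` for the lattice toric code under sector-wise minimum-weight decoding** — certified
two-sided interval (ceiling for every pair of decoder families; printed optimum `≈ .189` — VALIDATED column).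
[cite: DennisEtAl2002, §4.1 and §5.3; RichardsonUrbanke2008, Lemma 4.78] -/
theorem toric_depolarizing_accuracyThreshold_mem
    (DX : (L : ℕ) → Decoder (Syndrome (L + 1)) (Chain (L + 1))) (DZ : (L : ℕ) → ZDecoder (L + 1))
    (hDX : ∀ L, (DX L).IsMinWeight (toricCode (L + 1)).xSyndrome
      ((toricCode (L + 1)).kerZ : Set (Chain (L + 1))) hammingNorm)
    (hDZ : ∀ L, (DZ L).IsMinWeight (syn (L + 1)) (cycles (L + 1)) hammingNorm) :
    (0.0483 : ℝ) < accuracyThreshold (depolarizingFailureFamily (fun L => toricCode (L + 1)) DX DZ) ∧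
      accuracyThreshold (depolarizingFailureFamily (fun L => toricCode (L + 1)) DX DZ) ≤ 3 / 8 :=
  ⟨toric_depolarizing_accuracyThreshold_gt_0483 DX DZ hDX hDZ,
    depolarizingAccuracyThreshold_le_three_eighths (fun L => toricCode (L + 1)) (fun _ => toricCode_k_pos) DX DZ⟩

/-- **The exact identity for the lattice toric code**: `p_c^{depol} = (3/2)·min(p_c^X, p_c^Z)` for any pair of decoder
families (instance of `depolarizingAccuracyThreshold_eq`). [cite: DennisEtAl2002, §4.1 (X and Z errors corrected separately)] -/
theorem toric_depolarizingAccuracyThreshold_eq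
    (DX : (L : ℕ) → Decoder (Syndrome (L + 1)) (Chain (L + 1))) (DZ : (L : ℕ) → ZDecoder (L + 1)) :
    accuracyThreshold (depolarizingFailureFamily (fun L => toricCode (L + 1)) DX DZ) =
      3 / 2 * min (accuracyThreshold (xFailureFamily (fun L => toricCode (L + 1)) DX))
        (accuracyThreshold (zFailureFamily (fun L => toricCode (L + 1)) DZ)) :=
  depolarizingAccuracyThreshold_eq (fun L => toricCode (L + 1)) (fun _ => toricCode_k_pos) DX DZ

end Summit.Ventures.QEC.Thresholds
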